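import Mathlib
import HarnessLib

/-!
# Kottwitz 1992, §4 «Hermitian symmetric spaces of PEL type» — statement carpet (Lemmas 4.1, 4.2, 4.3)

R. E. Kottwitz, *Points on some Shimura varieties over finite fields*, J. Amer. Math. Soc. **5** (1992) 373–444
[Kottwitz1992], §4, pp. 385–389 (held text `paper:doi-10-2307-2152772`, PDF pages p0013–p0017 = printed pages 385–389).
Carpet-typing squad TK (cell hodgecm-mathlib, seat TK-t02): STATEMENTS ONLY — every numbered item of §4 is a named fact
`def Kottwitz1992_4_… : Prop := …` (D-0014: no proof, no `sorry`, no `axiom`, no `instance`, no notation); the two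
interface structures `SkewHermitianForm` / `HodgeMap` bundle the data `(B, *, V, ⟨·,·⟩, h)` of p. 387 verbatim.

## The print (verbatim, p. 385–388)

Setting (p. 385, p0013 L35–L45): «Let `C` be a semisimple finite-dimensional `ℝ`-algebra with involution `*`. Let
`h : ℂ → C` be an `ℝ`-algebra homomorphism such that `h(z̄) = h(z)*` for all `z ∈ ℂ`. Then `h(i)` is antisymmetric for `*`,
and therefore `ι(x) := h(i)⁻¹ x* h(i)` (`x ∈ C`) is an involution of `C`. Assume that `ι` is a positive involution. Let `G` be
the algebraic group over `ℝ` whose points in an `ℝ`-algebra `R` are given by `G(R) = {x ∈ C ⊗_ℝ R | x x* ∈ R^×}`, and let `G₁`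
be the closed subgroup such that `G₁(R) = {x ∈ C ⊗_ℝ R | x x* = 1}`.»  (Positive involution, §2 Definition p. 380 with
Lemma 2.2 (3): «`tr_{B/ℝ}(x x*) > 0` for all nonzero `x ∈ B`».)

«**Lemma 4.1.** The pair `(G, h)` satisfies the following three conditions. (1) The image under `h` of `ℝ^×` is central in
`G`. (2) Define `μ_h : 𝔾_m → G_ℂ` by restricting `h_ℂ : (R_{ℂ/ℝ}𝔾_m)_ℂ → G_ℂ` to the factor of `(R_{ℂ/ℝ}𝔾_m)_ℂ = 𝔾_m × 𝔾_m`
indexed by the identity map from `ℂ` to `ℂ` (the two factors of `𝔾_m` are indexed by the two `ℝ`-algebra maps from `ℂ` to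
`ℂ`). Then `𝔾_m`, acting on the Lie algebra `Lie(G_ℂ)` by means of `μ_h` and the adjoint action of `G_ℂ` on `Lie(G_ℂ)`, has
weights `1, 0, −1`. (3) The `ℝ`-form of `G₁` obtained by twisting `G₁` by the inner automorphism `Int(h(i))` is the compact
form of `G₁`.» (p. 386, p0014 L5–L14.)  Proof of (2), ibid. L16–L22: «(2) follows from the following easily verified fact:
Let `V` be a finite-dimensional complex vector space, let `h : ℂ^× → GL_ℝ(V)` […] Then `𝔾_m`, acting on the Lie algebra of
`GL_ℂ(V_ℂ)` by means of `μ_h` and the adjoint action, has weights `1, 0, −1`.»  Proof of (3), ibid. L23–L31: «To prove (3)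
we must show that the group `{x ∈ C ⊗_ℝ ℂ | x x* = 1 and h(i)⁻¹ x̄ h(i) = x}` is compact.»

Setting of Lemmas 4.2–4.3 (p. 387, p0015 L10–L27): «Let `B` be a semisimple finite-dimensional `ℝ`-algebra with positive
involution `*`. Let `V` be a finitely generated left `B`-module, and let `⟨v, w⟩` be a nondegenerate skew-Hermitian form on
`V` (in other words, a nondegenerate real-valued alternating bilinear form on `V` such that `⟨bv, w⟩ = ⟨v, b* w⟩` for all
`v, w ∈ V` and all `b ∈ B`). Let `h : ℂ → End_B(V)` be an `ℝ`-algebra homomorphism such that `⟨h(z)v, w⟩ = ⟨v, h(z̄)w⟩` for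
all `v, w ∈ V` and all `z ∈ ℂ`. Assume that the symmetric bilinear form `⟨v, h(i)w⟩` on `V` is positive definite. Now let
`C = End_B(V)`. The adjoint map for `⟨v, w⟩` gives an involution `*` on `C` […] Thus `(B, *, V, ⟨·,·⟩, h)` gives rise to
`(C, *, h)` and hence to `G`, `G₁`, and `X_∞` as before» (`X_∞` = «the set of conjugates of `h` under `G(ℝ)`», p. 386 L34).

«**Lemma 4.2.** Let `(B, *, V, ⟨·,·⟩, h)` be as before and assume that `⟨·,·⟩′` and `h′` satisfy the same conditions as
`⟨·,·⟩` and `h`. Assume further that the two `B ⊗_ℝ ℂ`-module structures on `V` obtained from `h` and `h′` are isomorphic.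
Then `(V, ⟨·,·⟩, h)` and `(V, ⟨·,·⟩′, h′)` are isomorphic as skew-Hermitian `B ⊗_ℝ ℂ`-modules. Moreover the set `X_∞` for
`(B, *, V, ⟨·,·⟩, h)` is equal to the set of `*`-homomorphisms `h′` from `ℂ` to `C = End_B(V)` satisfying the following two
conditions. (1) The form `⟨v, h′(i)w⟩` is positive or negative definite. (2) The two `B ⊗_ℝ ℂ`-module structures on `V`
obtained from `h` and `h′` are isomorphic.» (p. 387, p0015 L35–L44.)

«**Lemma 4.3.** Suppose that `B, *, V, ⟨·,·⟩, h` are as before and that `h′ : ℂ → C` is another `*`-homomorphism such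
that `⟨v, h′(i)w⟩` is positive definite. Then `h′` and `h` are conjugate under `G₁(ℝ)`.» (p. 388, p0016 L13–L15.)

Classification paragraph (p. 386 L40 – p. 387 L9): «classifying `ℝ`-algebra homomorphisms `ℂ → C` up to conjugacy by `C^×`
[…] If `D = ℝ` then `ℂ ⊗_ℝ D = ℂ`, and no `h` exists unless `n` is even, in which case it is unique up to inner
automorphisms […]. If `D = ℂ`, then `ℂ ⊗_ℝ D = ℂ × ℂ`, and […] there is a `*`-homomorphism `ℂ → C` for each pair `(p, q)` of
nonnegative integers such that `p + q = n`. If `D = ℍ`, then `ℂ ⊗_ℝ D` is isomorphic to `M₂(ℂ)`, and up to inner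
automorphisms of `(C, ι)`, there exists a unique `*`-homomorphism `h : ℂ → C`.»

## How the print is typed (design notes; every deviation is a SPECIALISATION, recorded here)

* The involution `*` is Mathlib's `star` (`[StarRing C] [StarModule ℝ C]`: `(xy)* = y* x*`, `x** = x`, `ℝ`-linear); a
  `*`-homomorphism `h : ℂ → C` with `h(z̄) = h(z)*` is a `StarAlgHom`, `h : ℂ →⋆ₐ[ℝ] C`.  Positivity of an involution is the
  trace condition of §2 Lemma 2.2 (3), written with Mathlib's `LinearMap.trace ℝ C ∘ LinearMap.mulLeft ℝ` (the trace of
  left multiplication; Mathlib's `Algebra.trace` is only declared for commutative algebras).  `h(i)⁻¹ = h(i⁻¹)` (`= −h(i)`).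
* Lemma 4.1 (1) is typed on points: `h(r)` (`r ∈ ℝ`) commutes with all of `C`, hence is central in `G(R) ⊆ C ⊗ R` for
  every `R`.  Lemma 4.1 (2) is typed in the form of the «easily verified fact» the print reduces it to: `μ_h(t)` is the
  element `1 + (t − 1) P` of `C_ℂ = ℂ ⊗_ℝ C` with `P = h_ℂ(e_id) = ½ (1 ⊗ 1 − i ⊗ h(i))` the image of the idempotent
  `e_id = ½ (1 ⊗ 1 − i ⊗ i)` of `ℂ ⊗_ℝ ℂ = ℂ × ℂ` cutting out the factor indexed by the identity (under `z ⊗ w ↦ (zw, z w̄)`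
  the element `(t, 1)` is `1 + (t − 1) e_id`), and «weights `1, 0, −1`» is the weight decomposition of the adjoint
  `𝔾_m`-action `X ↦ μ_h(t) X μ_h(t)⁻¹` on the Lie algebra `C_ℂ` of `(C ⊗ ℂ)^× ⊇ G_ℂ` (so on the `Ad`-stable `Lie(G_ℂ)`).
  Lemma 4.1 (3) is typed as the compactness of the group the print names, `{x ∈ C ⊗_ℝ ℂ | x x* = 1, h(i)⁻¹ x̄ h(i) = x}`, in
  the real coordinates `x = a ⊗ 1 + b ⊗ i ↔ (a, b) ∈ C × C` (`x x* = (aa* − bb*) + (ab* + ba*) i`, `x̄ = a − b i`), for the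
  (unique) Hausdorff topological-vector-space topology of the finite-dimensional `C`.
* Lemmas 4.2–4.3: the left `B`-module `V` is an `ℝ`-algebra map `ρ : B → End_ℝ(V)`; `C = End_B(V)` is the commutant of
  `ρ(B)` in `End_ℝ(V)`, so «`h : ℂ → End_B(V)`» is `h : ℂ →ₐ[ℝ] End_ℝ(V)` commuting with every `ρ(b)`; an isomorphism of
  `B ⊗_ℝ ℂ`-modules `(V, h) → (V, h′)` is an `ℝ`-linear automorphism `g` of `V` with `g ρ(b) = ρ(b) g` and
  `g h(z) = h′(z) g`; it is an isomorphism of skew-Hermitian `B ⊗_ℝ ℂ`-modules when moreover `⟨g v, g w⟩′ = ⟨v, w⟩`.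
  `G(ℝ) = {x ∈ C | x x* ∈ ℝ^×}` = the `B`-linear similitudes of `⟨·,·⟩`, `G₁(ℝ)` = the `B`-linear isometries.
* `-- TODO(general form):` Lemma 4.1 (2)/(3) for the algebraic groups `G_ℂ`, `G₁` themselves (Mathlib has no real forms /
  inner twists of linear algebraic groups); the statements above are the ones the print proves and uses.

## Dedup census (tree, 2026-09-02)

The only tree carrier of §4 is ★ `Literature/NumberTheory/Automorphic/UnitaryShimuraDatumAxioms.lean`
(`…UnitaryShimuraDatum.exists_weight_decomposition`, `isCompact_kInfty`, …): Lemma 4.1 (2)/(3) PROVED for the one diagonal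
datum `h(z) = diag(z, z̄, …, z̄)` on `M_n(ℂ)`; it is CITED here, not restated — the facts below are the general `(C, *, h)`.
No tree file states Lemmas 4.2, 4.3 or the `ℝ ∕ ℂ ∕ ℍ` classification (`rg 'cite: Kottwitz1992, §4'`, `lean search`).

## References

* [Kottwitz1992] §4 pp. 385–389; §2 Definition p. 380, Lemma 2.2 (positive involutions), Lemma 2.10 (p. 382).
* [Deligne1979ShimuraVarieties] P. Deligne, *Variétés de Shimura*, (2.1.1.1)–(2.1.1.3) (= «(1.5.1)–(1.5.3) of [D3]» in
  the print, p. 386 L32).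
-/

open scoped TensorProduct ComplexConjugate Quaternion

namespace Literature.NumberTheory.Kottwitz1992.HermitianSymmetricSpaces

universe u v

/-! ## §4.0 The data `(C, *, h)` (p. 385) and the involution `ι` -/

/-- The involution `ι(x) := h(i)⁻¹ x* h(i)` of `C` attached to a `*`-homomorphism `h : ℂ → C` (p. 385, p0013 L37–L38:
«`h(i)` is antisymmetric for `*`, and therefore `ι(x) := h(i)⁻¹ x* h(i)` is an involution of `C`»); `h(i)⁻¹ = h(i⁻¹)`.
[cite: Kottwitz1992, §4 (p. 385)] -/
noncomputable def iota {C : Type u} [Ring C] [Algebra ℝ C] [StarRing C] (h : ℂ →⋆ₐ[ℝ] C) (x : C) : C :=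
  h (Complex.I⁻¹) * star x * h Complex.I

/-- **Positivity of an involution** `τ` of the finite-dimensional `ℝ`-algebra `C` in the sense of §2 (Definition p. 380,
Lemma 2.2 (3)): `tr_{C/ℝ}(x τ(x)) > 0` for every nonzero `x`, the trace being that of left multiplication on `C`.
[cite: Kottwitz1992, §2 Lemma 2.2 (3) and Definition (p. 380)] -/
def IsPositiveFor (C : Type u) [Ring C] [Algebra ℝ C] (τ : C → C) : Prop :=
  ∀ x : C, x ≠ 0 → 0 < LinearMap.trace ℝ C (LinearMap.mulLeft ℝ (x * τ x))

/-! ## Lemma 4.1 (p. 386) -/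

/-- **Lemma 4.1 (1)** (p. 386, p0014 L6): «The image under `h` of `ℝ^×` is central in `G`» — on points: for `r ∈ ℝ^×`
the element `h(r)` of `C` commutes with every element of `C` (so with `G(R) ⊆ C ⊗_ℝ R` for every `ℝ`-algebra `R`).
[cite: Kottwitz1992, Lemma 4.1 (1) (p. 386)] -/
def Kottwitz1992_4_1_1_central : Prop :=
  ∀ (C : Type u) [Ring C] [Algebra ℝ C] [StarRing C] [StarModule ℝ C] (h : ℂ →⋆ₐ[ℝ] C) (r : ℝ), r ≠ 0 →
    ∀ x : C, h (r : ℂ) * x = x * h (r : ℂ)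

/-- The cocharacter `μ_h : 𝔾_m → (C ⊗_ℝ ℂ)^×` of Lemma 4.1 (2) on points: `μ_h(t) = 1 + (t − 1) · P` with
`P = h_ℂ(e_id) = ½ (1 ⊗ 1 − i ⊗ h(i)) ∈ ℂ ⊗_ℝ C`, the image under `h_ℂ = id_ℂ ⊗ h` of the idempotent `e_id = ½(1 ⊗ 1 − i ⊗ i)`
of `ℂ ⊗_ℝ ℂ ≅ ℂ × ℂ` projecting to the factor «indexed by the identity map from `ℂ` to `ℂ`» (p. 386, p0014 L7–L10).
[cite: Kottwitz1992, Lemma 4.1 (2) (p. 386)] -/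
noncomputable def muH {C : Type u} [Ring C] [Algebra ℝ C] [StarRing C] (h : ℂ →⋆ₐ[ℝ] C) (t : ℂ) : ℂ ⊗[ℝ] C :=
  1 + (t - 1) • ((2⁻¹ : ℂ) • ((1 : ℂ ⊗[ℝ] C) - Complex.I ⊗ₜ[ℝ] h Complex.I))

/-- **Lemma 4.1 (2)** (p. 386, p0014 L7–L12), in the form of the «easily verified fact» (ibid. L16–L22) the print derives
it from: under the adjoint action `X ↦ μ_h(t) X μ_h(t)⁻¹` of `𝔾_m` (through `μ_h`, `muH`) the Lie algebra `C_ℂ = ℂ ⊗_ℝ C` of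
`(C ⊗_ℝ ℂ)^×` — which contains the `Ad`-stable `Lie(G_ℂ)` — is the sum of its weight spaces for the weights `1, 0, −1`:
every `X` is `X₁ + X₀ + Xneg` with `μ_h(t) X_k μ_h(t⁻¹) = t^k X_k` for all `t ∈ ℂ^×`.
[cite: Kottwitz1992, Lemma 4.1 (2) (p. 386)] -/
def Kottwitz1992_4_1_2_weights : Prop :=
  ∀ (C : Type u) [Ring C] [Algebra ℝ C] [StarRing C] [StarModule ℝ C] (h : ℂ →⋆ₐ[ℝ] C) (X : ℂ ⊗[ℝ] C),
    ∃ X₁ X₀ Xneg : ℂ ⊗[ℝ] C, X = X₁ + X₀ + Xneg ∧ ∀ t : ℂ, t ≠ 0 →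
      muH h t * X₁ * muH h t⁻¹ = t • X₁ ∧ muH h t * X₀ * muH h t⁻¹ = X₀ ∧ muH h t * Xneg * muH h t⁻¹ = t⁻¹ • Xneg

/-- **Lemma 4.1 (3)** (p. 386, p0014 L13–L14 and L23–L31): assuming `ι` is positive, «the `ℝ`-form of `G₁` obtained by
twisting `G₁` by `Int(h(i))` is the compact form of `G₁`», i.e. (proof, L23–L24) «the group
`{x ∈ C ⊗_ℝ ℂ | x x* = 1 and h(i)⁻¹ x̄ h(i) = x}` is compact» — written in the real coordinates `x = a ⊗ 1 + b ⊗ i ↔ (a, b)`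
of `C ⊗_ℝ ℂ = C ⊕ C i` (`x x* = (a a* − b b*) + (a b* + b a*) i`, `x̄ = a − b i`, so the two conditions read
`a a* − b b* = 1`, `a b* + b a* = 0`, `a h(i) = h(i) a`, `h(i) b = − b h(i)`), for the Hausdorff topological-vector-space
topology of the finite-dimensional real vector space `C`.
[cite: Kottwitz1992, Lemma 4.1 (3) (p. 386)] -/
def Kottwitz1992_4_1_3_compact : Prop :=
  ∀ (C : Type u) [Ring C] [Algebra ℝ C] [StarRing C] [StarModule ℝ C] [FiniteDimensional ℝ C] [IsSemisimpleRing C]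
    [TopologicalSpace C] [IsTopologicalAddGroup C] [ContinuousSMul ℝ C] [T2Space C] (h : ℂ →⋆ₐ[ℝ] C),
    IsPositiveFor C (iota h) →
    IsCompact {p : C × C | p.1 * star p.1 - p.2 * star p.2 = 1 ∧ p.1 * star p.2 + p.2 * star p.1 = 0 ∧
      p.1 * h Complex.I = h Complex.I * p.1 ∧ h Complex.I * p.2 = -(p.2 * h Complex.I)}

/-! ## The data `(B, *, V, ⟨·,·⟩, h)` of p. 387 -/

/-- A **nondegenerate skew-Hermitian form** on the left `B`-module `V` (p. 387, p0015 L11–L14): «a nondegenerate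
real-valued alternating bilinear form on `V` such that `⟨bv, w⟩ = ⟨v, b* w⟩` for all `v, w ∈ V` and all `b ∈ B`»; the
`B`-module structure on the real vector space `V` is the `ℝ`-algebra map `ρ : B → End_ℝ(V)`.
[cite: Kottwitz1992, §4 (p. 387)] -/
structure SkewHermitianForm {B : Type u} [Ring B] [Algebra ℝ B] [StarRing B] {V : Type v} [AddCommGroup V]
    [Module ℝ V] (ρ : B →ₐ[ℝ] Module.End ℝ V) where
  /-- the bilinear form `⟨v, w⟩` -/
  form : LinearMap.BilinForm ℝ V
  /-- alternating: `⟨v, v⟩ = 0` -/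
  isAlt : ∀ v : V, form v v = 0
  /-- nondegenerate -/
  nondegenerate : form.Nondegenerate
  /-- skew-Hermitian for `*`: `⟨b v, w⟩ = ⟨v, b* w⟩` -/
  skew : ∀ (b : B) (v w : V), form (ρ b v) w = form v (ρ (star b) w)

/-- The homomorphism `h` of p. 387 (p0015 L14–L17) for the skew-Hermitian `B`-module `(V, ⟨·,·⟩)`: «`h : ℂ → End_B(V)` an
`ℝ`-algebra homomorphism such that `⟨h(z)v, w⟩ = ⟨v, h(z̄)w⟩` […]. Assume that the symmetric bilinear form `⟨v, h(i)w⟩` on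
`V` is positive definite.»  (`End_B(V)` = the commutant of `ρ(B)` in `End_ℝ(V)`; by p0015 L19–L22 `h` is then a
`*`-homomorphism for the adjoint involution of `C = End_B(V)`.)
[cite: Kottwitz1992, §4 (p. 387)] -/
structure HodgeMap {B : Type u} [Ring B] [Algebra ℝ B] [StarRing B] {V : Type v} [AddCommGroup V] [Module ℝ V]
    {ρ : B →ₐ[ℝ] Module.End ℝ V} (ψ : SkewHermitianForm ρ) where
  /-- `h : ℂ → End_ℝ(V)` -/
  h : ℂ →ₐ[ℝ] Module.End ℝ V
  /-- `h(z) ∈ End_B(V)` -/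
  comm : ∀ (z : ℂ) (b : B), h z * ρ b = ρ b * h z
  /-- `⟨h(z) v, w⟩ = ⟨v, h(z̄) w⟩` -/
  adjoint : ∀ (z : ℂ) (v w : V), ψ.form (h z v) w = ψ.form v (h (conj z) w)
  /-- `⟨v, h(i) v⟩ > 0` for `v ≠ 0` -/
  pos : ∀ v : V, v ≠ 0 → 0 < ψ.form v (h Complex.I v)

/-- The set `X_∞` of `(B, *, V, ⟨·,·⟩, h)` (p. 386 L34, p. 387 L27): the conjugates `Int(g) ∘ h` of `h` under
`G(ℝ) = {g ∈ C | g g* ∈ ℝ^×}`, i.e. under the `B`-linear similitudes `g` of `⟨·,·⟩` (`⟨g v, g w⟩ = c ⟨v, w⟩`, `c ∈ ℝ^×`),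
as a set of `ℝ`-algebra maps `ℂ → End_ℝ(V)`. [cite: Kottwitz1992, §4 (pp. 386–387)] -/
def XInfty {B : Type u} [Ring B] [Algebra ℝ B] [StarRing B] {V : Type v} [AddCommGroup V] [Module ℝ V]
    {ρ : B →ₐ[ℝ] Module.End ℝ V} {ψ : SkewHermitianForm ρ} (η : HodgeMap ψ) : Set (ℂ →ₐ[ℝ] Module.End ℝ V) :=
  {h' | ∃ (g : V ≃ₗ[ℝ] V) (c : ℝ), c ≠ 0 ∧ (∀ (b : B) (v : V), g (ρ b v) = ρ b (g v)) ∧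
    (∀ v w : V, ψ.form (g v) (g w) = c * ψ.form v w) ∧ ∀ (z : ℂ) (v : V), h' z (g v) = g (η.h z v)}

/-! ## Lemma 4.2 (p. 387) -/

/-- **Lemma 4.2, first statement** (p. 387, p0015 L35–L39): `B` semisimple finite-dimensional with positive involution,
`V` finitely generated; if `(⟨·,·⟩, h)` and `(⟨·,·⟩′, h′)` both satisfy the conditions of p. 387 and the two
`B ⊗_ℝ ℂ`-module structures on `V` obtained from `h` and `h′` are isomorphic, then `(V, ⟨·,·⟩, h)` and `(V, ⟨·,·⟩′, h′)` are
isomorphic as skew-Hermitian `B ⊗_ℝ ℂ`-modules: some `B ⊗_ℝ ℂ`-linear automorphism `g` of `V` (`g ρ(b) = ρ(b) g`,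
`g h(z) = h′(z) g`) carries `⟨·,·⟩` to `⟨·,·⟩′`. [cite: Kottwitz1992, Lemma 4.2 (p. 387)] -/
def Kottwitz1992_4_2_iso : Prop :=
  ∀ (B : Type u) [Ring B] [Algebra ℝ B] [StarRing B] [StarModule ℝ B] [FiniteDimensional ℝ B] [IsSemisimpleRing B]
    (V : Type v) [AddCommGroup V] [Module ℝ V] [FiniteDimensional ℝ V] (ρ : B →ₐ[ℝ] Module.End ℝ V)
    (ψ ψ' : SkewHermitianForm ρ) (η : HodgeMap ψ) (η' : HodgeMap ψ'),
    IsPositiveFor B star →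
    (∃ f : V ≃ₗ[ℝ] V, (∀ (b : B) (v : V), f (ρ b v) = ρ b (f v)) ∧ ∀ (z : ℂ) (v : V), f (η.h z v) = η'.h z (f v)) →
    ∃ g : V ≃ₗ[ℝ] V, (∀ (b : B) (v : V), g (ρ b v) = ρ b (g v)) ∧ (∀ (z : ℂ) (v : V), g (η.h z v) = η'.h z (g v)) ∧
      ∀ v w : V, ψ'.form (g v) (g w) = ψ.form v w

/-- **Lemma 4.2, second statement** (p. 387, p0015 L39–L44): `X_∞` (`XInfty`) is the set of `*`-homomorphisms
`h′ : ℂ → C = End_B(V)` (`ℝ`-algebra maps commuting with `ρ(B)` with `⟨h′(z)v, w⟩ = ⟨v, h′(z̄)w⟩`) such that (1) the form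
`⟨v, h′(i)w⟩` is positive or negative definite and (2) the `B ⊗_ℝ ℂ`-module structures on `V` obtained from `h` and `h′` are
isomorphic. [cite: Kottwitz1992, Lemma 4.2 (p. 387)] -/
def Kottwitz1992_4_2_XInfty : Prop :=
  ∀ (B : Type u) [Ring B] [Algebra ℝ B] [StarRing B] [StarModule ℝ B] [FiniteDimensional ℝ B] [IsSemisimpleRing B]
    (V : Type v) [AddCommGroup V] [Module ℝ V] [FiniteDimensional ℝ V] (ρ : B →ₐ[ℝ] Module.End ℝ V)
    (ψ : SkewHermitianForm ρ) (η : HodgeMap ψ) (h' : ℂ →ₐ[ℝ] Module.End ℝ V),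
    IsPositiveFor B star → (∀ (z : ℂ) (b : B), h' z * ρ b = ρ b * h' z) →
    (∀ (z : ℂ) (v w : V), ψ.form (h' z v) w = ψ.form v (h' (conj z) w)) →
    (h' ∈ XInfty η ↔
      ((∀ v : V, v ≠ 0 → 0 < ψ.form v (h' Complex.I v)) ∨ (∀ v : V, v ≠ 0 → ψ.form v (h' Complex.I v) < 0)) ∧
      ∃ f : V ≃ₗ[ℝ] V, (∀ (b : B) (v : V), f (ρ b v) = ρ b (f v)) ∧ ∀ (z : ℂ) (v : V), f (η.h z v) = h' z (f v))

/-! ## Lemma 4.3 (p. 388) -/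

/-- **Lemma 4.3** (p. 388, p0016 L13–L15): if `h′ : ℂ → C` is another `*`-homomorphism with `⟨v, h′(i)w⟩` positive
definite — i.e. `(⟨·,·⟩, h′)` again satisfies the conditions of p. 387 — then `h′` and `h` are conjugate under
`G₁(ℝ) = {c ∈ C | c c* = 1}`: there is a `B`-linear isometry `c` of `(V, ⟨·,·⟩)` with `c h(z) c⁻¹ = h′(z)`.
[cite: Kottwitz1992, Lemma 4.3 (p. 388)] -/
def Kottwitz1992_4_3_conj : Prop :=
  ∀ (B : Type u) [Ring B] [Algebra ℝ B] [StarRing B] [StarModule ℝ B] [FiniteDimensional ℝ B] [IsSemisimpleRing B]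
    (V : Type v) [AddCommGroup V] [Module ℝ V] [FiniteDimensional ℝ V] (ρ : B →ₐ[ℝ] Module.End ℝ V)
    (ψ : SkewHermitianForm ρ) (η η' : HodgeMap ψ), IsPositiveFor B star →
    ∃ c : V ≃ₗ[ℝ] V, (∀ (b : B) (v : V), c (ρ b v) = ρ b (c v)) ∧ (∀ v w : V, ψ.form (c v) (c w) = ψ.form v w) ∧
      ∀ (z : ℂ) (v : V), c (η.h z v) = η'.h z (c v)

/-! ## The classification of `(C, ι, h)` for `C = M_n(D)`, `D = ℝ, ℂ, ℍ` (pp. 386–387) -/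

/-- **Case `D = ℝ`** (p. 386, p0014 L47–L48): «If `D = ℝ` then `ℂ ⊗_ℝ D = ℂ`, and no `h` exists unless `n` is even, in which
case it is unique up to inner automorphisms» — `ℝ`-algebra maps `ℂ → M_n(ℝ)` exist iff `n` is even, and any two are
conjugate under `GL_n(ℝ)` (ibid. L40–L42: «classifying `ℝ`-algebra homomorphisms `ℂ → C` up to conjugacy by `C^×`»).
[cite: Kottwitz1992, §4 (p. 386)] -/
def Kottwitz1992_4_class_real : Prop :=
  ∀ n : ℕ, (Nonempty (ℂ →ₐ[ℝ] Matrix (Fin n) (Fin n) ℝ) ↔ Even n) ∧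
    ∀ h h' : ℂ →ₐ[ℝ] Matrix (Fin n) (Fin n) ℝ, ∃ g : (Matrix (Fin n) (Fin n) ℝ)ˣ,
      ∀ z : ℂ, h' z = (g : Matrix (Fin n) (Fin n) ℝ) * h z * (g⁻¹ : (Matrix (Fin n) (Fin n) ℝ)ˣ)

/-- **Case `D = ℂ`** (p. 386 L48 – p. 387 L1): «If `D = ℂ`, then `ℂ ⊗_ℝ D = ℂ × ℂ`, and up to inner automorphisms […] there
is a `*`-homomorphism `ℂ → C` for each pair `(p, q)` of nonnegative integers such that `p + q = n`» — every `ℝ`-algebra map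
`h : ℂ → M_n(ℂ)` is `GL_n(ℂ)`-conjugate to `z ↦ diag(z, …, z, z̄, …, z̄)` (`p` entries `z`, `q = n − p` entries `z̄`) for
exactly one `p ≤ n`. [cite: Kottwitz1992, §4 (pp. 386–387)] -/
def Kottwitz1992_4_class_complex : Prop :=
  ∀ (n : ℕ) (h : ℂ →ₐ[ℝ] Matrix (Fin n) (Fin n) ℂ), ∃! p : ℕ, p ≤ n ∧ ∃ g : (Matrix (Fin n) (Fin n) ℂ)ˣ, ∀ z : ℂ,
    h z = (g : Matrix (Fin n) (Fin n) ℂ) *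
      Matrix.diagonal (fun i : Fin n => if (i : ℕ) < p then z else conj z) * (g⁻¹ : (Matrix (Fin n) (Fin n) ℂ)ˣ)

/-- **Case `D = ℍ`** (p. 387, p0015 L1–L3): «If `D = ℍ`, then `ℂ ⊗_ℝ D` is isomorphic to `M₂(ℂ)`, and up to inner
automorphisms of `(C, ι)`, there exists a unique `*`-homomorphism `h : ℂ → C`» — `ℝ`-algebra maps `ℂ → M_n(ℍ)` exist for
every `n` and any two are conjugate under `GL_n(ℍ)`. [cite: Kottwitz1992, §4 (p. 387)] -/
def Kottwitz1992_4_class_quaternion : Prop :=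
  ∀ n : ℕ, Nonempty (ℂ →ₐ[ℝ] Matrix (Fin n) (Fin n) ℍ[ℝ]) ∧
    ∀ h h' : ℂ →ₐ[ℝ] Matrix (Fin n) (Fin n) ℍ[ℝ], ∃ g : (Matrix (Fin n) (Fin n) ℍ[ℝ])ˣ,
      ∀ z : ℂ, h' z = (g : Matrix (Fin n) (Fin n) ℍ[ℝ]) * h z * (g⁻¹ : (Matrix (Fin n) (Fin n) ℍ[ℝ])ˣ)


/-! ## Discharges (ED. 2, paydown): «Statement (1) is obvious» (p. 386, p0014 L15) -/

/-- **Lemma 4.1 (1) holds**: `h(r) = r · 1` is the image of `r` under the structure map `ℝ → C` (an `ℝ`-algebra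
homomorphism commutes with the structure maps), hence central. [cite: Kottwitz1992, Lemma 4.1 (1) (p. 386)] -/
theorem Kottwitz1992_4_1_1_central_holds : Kottwitz1992_4_1_1_central.{u} := by
  intro C _ _ _ _ h r _ x
  rw [show h (r : ℂ) = algebraMap ℝ C r from AlgHomClass.commutes h r]
  exact Algebra.commutes r x


/-! ## Discharge of Lemma 4.1 (2) (ED. 3, paydown): the idempotent `P = h_ℂ(e_id)` and the weight decomposition
`X = PXQ + (PXP + QXQ) + QXP` (p. 386, p0014 L16–L22 «easily verified fact») -/

section WeightsProof

variable {C : Type u} [Ring C] [Algebra ℝ C] [StarRing C] (h : ℂ →⋆ₐ[ℝ] C)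

/-- `E = i ⊗ h(i) ∈ ℂ ⊗_ℝ C`, the image of `i ⊗ i` under `h_ℂ`. [cite: Kottwitz1992, Lemma 4.1 (2) (p. 386)] -/
private noncomputable def weightE : ℂ ⊗[ℝ] C := Complex.I ⊗ₜ[ℝ] h Complex.I

/-- `E² = 1` (`i² = −1` twice). [cite: Kottwitz1992, Lemma 4.1 (2) (p. 386)] -/
private theorem weightE_mul_weightE : weightE h * weightE h = 1 := by
  simp only [weightE, Algebra.TensorProduct.tmul_mul_tmul, Complex.I_mul_I, ← map_mul, map_neg, map_one,
    Algebra.TensorProduct.one_def]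
  simp [TensorProduct.neg_tmul, TensorProduct.tmul_neg]

/-- `P = ½ (1 − E) = h_ℂ(e_id)`. [cite: Kottwitz1992, Lemma 4.1 (2) (p. 386)] -/
private noncomputable def weightP : ℂ ⊗[ℝ] C := (2⁻¹ : ℂ) • (1 - weightE h)

/-- `Q = 1 − P`. [cite: Kottwitz1992, Lemma 4.1 (2) (p. 386)] -/
private noncomputable def weightQ : ℂ ⊗[ℝ] C := 1 - weightP h

/-- `P² = P`. [cite: Kottwitz1992, Lemma 4.1 (2) (p. 386)] -/
private theorem weightP_mul_weightP : weightP h * weightP h = weightP h := by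
  have hE := weightE_mul_weightE h
  simp only [weightP, smul_mul_assoc, mul_smul_comm, smul_smul]
  have h2 : (1 - weightE h) * (1 - weightE h) = (2 : ℂ) • (1 - weightE h) := by
    rw [sub_mul, mul_sub, mul_sub, one_mul, one_mul, mul_one, hE, two_smul]; abel
  rw [h2, smul_smul]; norm_num

/-- `P + Q = 1`. [cite: Kottwitz1992, Lemma 4.1 (2) (p. 386)] -/
private theorem weightP_add_weightQ : weightP h + weightQ h = 1 := by simp [weightQ]

/-- `P Q = 0`. [cite: Kottwitz1992, Lemma 4.1 (2) (p. 386)] -/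
private theorem weightP_mul_weightQ : weightP h * weightQ h = 0 := by simp [weightQ, mul_sub, weightP_mul_weightP]

/-- `Q P = 0`. [cite: Kottwitz1992, Lemma 4.1 (2) (p. 386)] -/
private theorem weightQ_mul_weightP : weightQ h * weightP h = 0 := by simp [weightQ, sub_mul, weightP_mul_weightP]

/-- `Q² = Q`. [cite: Kottwitz1992, Lemma 4.1 (2) (p. 386)] -/
private theorem weightQ_mul_weightQ : weightQ h * weightQ h = weightQ h := by
  simp [weightQ, mul_sub, sub_mul, weightP_mul_weightP]

/-- `μ_h(t) = Q + t P`. [cite: Kottwitz1992, Lemma 4.1 (2) (p. 386)] -/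
private theorem muH_eq_weightQ_add (t : ℂ) : muH h t = weightQ h + t • weightP h := by
  rw [show muH h t = 1 + (t - 1) • weightP h from rfl, weightQ, sub_smul, one_smul]; abel

/-- Weight `1`: `μ(t) (P X Q) μ(t⁻¹) = t · P X Q`. [cite: Kottwitz1992, Lemma 4.1 (2) (p. 386)] -/
private theorem muH_conj_weight_one (t : ℂ) (X : ℂ ⊗[ℝ] C) :
    muH h t * (weightP h * X * weightQ h) * muH h t⁻¹ = t • (weightP h * X * weightQ h) := by
  simp only [muH_eq_weightQ_add, add_mul, mul_add, smul_mul_assoc, mul_smul_comm, smul_smul, ← mul_assoc,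
    weightQ_mul_weightP, weightP_mul_weightP, zero_add]
  simp only [mul_assoc, weightQ_mul_weightQ, weightQ_mul_weightP, mul_zero, smul_zero, add_zero]

/-- Weight `−1`: `μ(t) (Q X P) μ(t⁻¹) = t⁻¹ · Q X P`. [cite: Kottwitz1992, Lemma 4.1 (2) (p. 386)] -/
private theorem muH_conj_weight_neg_one (t : ℂ) (X : ℂ ⊗[ℝ] C) :
    muH h t * (weightQ h * X * weightP h) * muH h t⁻¹ = t⁻¹ • (weightQ h * X * weightP h) := by
  simp only [muH_eq_weightQ_add, add_mul, mul_add, smul_mul_assoc, mul_smul_comm, ← mul_assoc,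
    weightQ_mul_weightQ, weightP_mul_weightQ, smul_zero, add_zero]
  simp only [mul_assoc, weightP_mul_weightQ, weightP_mul_weightP, mul_zero, zero_add]

/-- Weight `0`: `μ(t) (P X P + Q X Q) μ(t⁻¹) = P X P + Q X Q` (`t ≠ 0`). [cite: Kottwitz1992, Lemma 4.1 (2) (p. 386)] -/
private theorem muH_conj_weight_zero {t : ℂ} (ht : t ≠ 0) (X : ℂ ⊗[ℝ] C) :
    muH h t * (weightP h * X * weightP h + weightQ h * X * weightQ h) * muH h t⁻¹ =
      weightP h * X * weightP h + weightQ h * X * weightQ h := by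
  simp only [muH_eq_weightQ_add, add_mul, mul_add, smul_mul_assoc, mul_smul_comm, ← mul_assoc,
    weightQ_mul_weightQ, weightQ_mul_weightP, weightP_mul_weightQ, weightP_mul_weightP, smul_zero, add_zero,
    zero_add]
  simp only [mul_assoc, weightQ_mul_weightQ, weightQ_mul_weightP, weightP_mul_weightQ, weightP_mul_weightP, mul_zero,
    smul_zero, add_zero, zero_add, smul_smul, inv_mul_cancel₀ ht, one_smul]
  abel

end WeightsProof

/-- **Lemma 4.1 (2) holds** in the typed form: with `P = h_ℂ(e_id)` (`P² = P` since `(i ⊗ h(i))² = 1`) and `Q = 1 − P`,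
`μ_h(t) = Q + tP`, and `X = PXQ + (PXP + QXQ) + QXP` is the decomposition into the weight spaces `1, 0, −1` of
`X ↦ μ_h(t) X μ_h(t⁻¹)` — the «easily verified fact» of p. 386. [cite: Kottwitz1992, Lemma 4.1 (2) (p. 386)] -/
theorem Kottwitz1992_4_1_2_weights_holds : Kottwitz1992_4_1_2_weights.{u} := by
  intro C _ _ _ _ h X
  refine ⟨weightP h * X * weightQ h, weightP h * X * weightP h + weightQ h * X * weightQ h, weightQ h * X * weightP h,
    ?_, fun t ht => ⟨muH_conj_weight_one h t X, muH_conj_weight_zero h ht X, muH_conj_weight_neg_one h t X⟩⟩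
  have h1 : X = (weightP h + weightQ h) * X * (weightP h + weightQ h) := by rw [weightP_add_weightQ, one_mul, mul_one]
  conv_lhs => rw [h1]
  simp only [add_mul, mul_add]
  abel

end Literature.NumberTheory.Kottwitz1992.HermitianSymmetricSpaces
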